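import Summits.BirchSwinnertonDyer.BirchSwinnertonDyer.Theorems.PrintX10bBeyondCarrierOfUpperLinkV5
import Summits.BirchSwinnertonDyer.BirchSwinnertonDyer.Theorems.PrintX10bBeyondCarrierUpperLinkCoprimePinned
import Summits.BirchSwinnertonDyer.BirchSwinnertonDyer.Theorems.PrintX9HowardContainmentLightFrameOfPrintDepthPosLocalized
import Literature.NumberTheory.EllipticCurves.IwasawaAlgebraPromotionProofs
import HarnessLib

/-!
# Crux `BeyondCarrierDepthX10b` (stmt-BirchSwinnertonDyer-23055, `route-BirchSwinnertonDyer-PrintX10b` rev 19),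
# line «twins», skeleton v6.1: the crux BY NAME from the envelope and the μ-INEQUALITY
# `μ(X_tors) ≤ 2·μ(𝔖/ℋ_F)` on the `3 ∣ h_K` X10b frames — modulo ten cite-only facts (SHARP census of v6.1)

HONEST FRAMING (cell `run/shared/lean/pub/bsd-print-x9/`, LEAD seat bsd-line-x10b-p1 g2 of the registered line on
crux 23055, D-0154 KEY row 10): THEOREMS ONLY, conditional glue `--supports 23055`; nothing booked, nothing closed.
«beyond-print theorem»: NO. BSD is not proved by any of this; no summit statement is proved by this seat.

WHY. The companion file `PrintX10bBeyondCarrierOfEnvelopeAndMu.lean` derives the crux from the envelope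
`s_env` and `μ(X_tors) = 0`. But the μ-part of Howard's divisibility needs LESS: by the promotion lemma with a
μ-inequality (`IwasawaAlgebra.sq_charIdeal_le_charIdeal_of_span_p_pow_mul_le_of_lengthAt_le_two_mul`, p613811),
`(p^m)·I(ℋ_F)² ⊆ char_Λ(X_tors)` promotes to `I(ℋ_F)² ⊆ char_Λ(X_tors)` as soon as `μ(X_tors) ≤ 2·μ(𝔖/ℋ_F)`
(local lengths at `(p)`), an inequality IMPLIED by Perrin-Riou's Heegner-point main conjecture (equality
`char(X_tors) = I(ℋ)²`), whereas `μ(X_tors) = 0` additionally forces `μ(𝔖/ℋ_F) = 0` (non-divisibility of the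
tied Λ-adic Heegner class by `p` in `𝔖` — Cornut–Vatsal, printed only under surjective image). So the SHARP
census of crux 23055 (numbers): 2 open statements — `s_env` (envelope with `𝔖/ℋ_F` torsion: the letter of
26359's `stub_envelopeTied`; research M–L, class-free) and `hμle` (the μ-INEQUALITY on the rank-one `3 ∣ h_K`
X10b frames for the TIED family; research, beyond print, BSD/HPMC-implied) — and the same 10 cite-only facts as
the companion file (`h46`, `hCGLS`, `h57`, `h59gp`, `h422`, `h513`, `hC`, `h331`, `hChaL`, `hKo`).
«beyond-print theorem»: NO.

WHAT.
* `upperLinkX10b_divisibleClassNumber_of_envelope_of_muLe_of_printFacts (hCGLS h57 h59gp h422 h513 hC h331)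
  (s_env) (hμle)` — v5's open stub (U₃ on the `3 ∣ h_K` frames) BY SIGNATURE: `jbar := IsAlgClosed.lift ιC`;
  `D`, `X` exist; `(C, F, e, torsion) ← s_env`; CGLS 4.1.3 at `(D, C, X)` (gives `𝔖` and `X.X` f.g.);
  `(p^{m+2e})·I(ℋ_F)² ⊆ char`; promotion by the μ-inequality; pinned transfer; `≤` half.
* `beyondCarrierDepthX10b_of_envelope_of_muLe_of_namedFacts (…) (s_env) (hμle) : BeyondCarrierDepthX10b`.

References: [CastellaGrossiLeeSkinner2022] Thm. 4.1.3, Cor. 3.4.2, Rem. 4.1.4, Thm. 5.1.3; [MastellaZerman2026]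
Cor. 4.6; [YanZhu2024MainConjNonCM] Thm. 5.7 (1), 5.9; [BurungaleCastellaSkinner2025] Prop. 4.2.2;
[JetchevSkinnerWan2017] Thm. 3.3.1; [Cha2005] Rmk. 25; [Kolyvagin1990] Thm. A; [Castella2018] §5;
[Washington1997] §13.2; skeleton v6 `Cruxes/BeyondCarrierDepthX10b/Lines/twins.lean`.
-/

-- the REGISTERED stub namespace `Summit.BirchSwinnertonDyer.BirchSwinnertonDyer.Cruxes.…` repeats the summit name
set_option linter.dupNamespace false
set_option autoImplicit false

noncomputable section

open scoped Classical

open WeierstrassCurve NumberField IsDedekindDomain Field Literature.NumberTheory.EllipticCurves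
  Literature.NumberTheory.EllipticCurves.ModularForms Literature.NumberTheory.EllipticCurves.Rank1Residual
  Literature.NumberTheory.EllipticCurves.Castella2018 Literature.NumberTheory.EllipticCurves.YanZhu2026
  Literature.NumberTheory.EllipticCurves.CastellaGrossiLeeSkinner2022
  Literature.NumberTheory.EllipticCurves.JetchevSkinnerWan2017

open Summit.BirchSwinnertonDyer.Rank1Residual
open Summit.BirchSwinnertonDyer.BirchSwinnertonDyer.Rank1Residual (X10.thm413Hypotheses_of_classX10)
open Summit.BirchSwinnertonDyer.BirchSwinnertonDyer.Cruxes.TwoSidedLinkAnyClassNumberX10b.CompositeTransferX10b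
  (imcWaldspurgerOnTreeGoodAt_inducedPlace_of_printFacts_of_pinnedTransfer)
open Summit.BirchSwinnertonDyer.BirchSwinnertonDyer.Cruxes.BeyondCarrierDepthX10b.UpperHalf
  (upperLink_of_imcWaldspurgerOnTreeGoodAt upperLinkX10b_coprimeClassNumber_of_pinnedPrintFacts)
open Summit.BirchSwinnertonDyer.BirchSwinnertonDyer.Theses.PrintX10b (BeyondCarrierDepthX10b)

namespace Summit.BirchSwinnertonDyer.BirchSwinnertonDyer.Cruxes.BeyondCarrierDepthX10b.HowardFrames

/-- Ideal bookkeeping: `(a) · ((b) · I)² = (a·b²) · I²`. [folklore] -/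
theorem span_singleton_mul_sq_eq' {R : Type*} [CommSemiring R] (a b : R) (I : Ideal R) :
    Ideal.span {a} * (Ideal.span {b} * I) ^ 2 = Ideal.span {a * b ^ 2} * I ^ 2 := by
  rw [mul_pow, Ideal.span_singleton_pow, ← mul_assoc, Ideal.span_singleton_mul_span_singleton]

/-- **v5's open stub `stub_upperLink_divisibleClassNumber` (U₃ on the `3 ∣ h_K` X10b frames) BY SIGNATURE from
the TWO open statements of skeleton v6.1 — the envelope `s_env` and the μ-INEQUALITY `hμle` — modulo seven
print facts** (`hCGLS` CGLS Thm. 4.1.3 localized; `h57 h59gp h422 h513 hC h331` the pinned class-number-free transfer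
inputs). Chain: `jbar := IsAlgClosed.lift` along `ιC`; data `D`, `X` by the tree's existence theorems;
`(C, F, e, torsion) ← s_env`; CGLS at `(D, C, X)`; `(p^{m+2e})·I(ℋ_F)² ⊆ char_Λ(X_tors)`; promotion by the
μ-inequality (p613811); transfer; `≤` half. [cite: CastellaGrossiLeeSkinner2022, Thm. 4.1.3 + Cor. 3.4.2 + Rem. 4.1.4] [cite: Washington1997, §13.2]
[cite: YanZhu2024MainConjNonCM, Thm. 5.7 (1) and Thm. 5.9] [cite: BurungaleCastellaSkinner2025, Prop. 4.2.2]
[cite: JetchevSkinnerWan2017, Thm. 3.3.1] [cite: Castella2018, §5 (eq:IMC+BDP)] -/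
theorem upperLinkX10b_divisibleClassNumber_of_envelope_of_muLe_of_printFacts
    (hCGLS : thm413_rankOne_charIdeal_torsion_dvd_localized.{0})
    (h57 : thm57_isTorsion_charIdealXGr_eq_bdpLFunction)
    (h59gp : ∀ {p : ℕ} [Fact p.Prime] (ι' : PadicAlgCl p ≃+* ℂ) (W : WeierstrassCurve ℚ) [W.IsElliptic]
      [W.IsGloballyMinimal] (K : Type) [Field K] [NumberField K] (v vbar : HeightOneSpectrum (𝓞 K))
      (κ : ZpExtension K p) (γ : absoluteGaloisGroup K) [Fact (κ.IsTopGenerator γ)] {N : ℕ} [NeZero N]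
      {f : CuspForm (CongruenceSubgroup.Gamma0 N) 2} (jbar : AlgebraicClosure K →+* ℂ)
      (_ : IsNewformOf W f),
      N = W.conductorNorm ℤ → 3 ≤ p → GoodOrd W p → (W.baseChange K).HasIrreducibleModPGaloisRep p →
      IsImaginaryQuadratic K → SatisfiesHeegnerHypothesis N K →
        ((Ideal.span {(p : ℤ)}).primesOver (𝓞 K)).ncard = 2 →
        Odd (NumberField.discr K) → NumberField.discr K ≠ -3 → κ.IsAnticyclotomic →
      (∀ (w : InfinitePlace K) (k : 𝓞 K), k ∈ v.asIdeal ↔ ‖ι'.symm (w.embedding (k : K))‖ < 1) →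
        ((p : ℕ) : 𝓞 K) ∈ vbar.asIdeal → vbar ≠ v →
      ∃ (ΩK : ℂ) (Ωp : (unrIntegers p)ˣ) (L : UnrSeries p),
        ΩK ≠ 0 ∧ IsBDPLFunction ι' v κ γ f ΩK ((Ωp : unrIntegers p) : ℂ_[p]) L ∧
        ∀ (D : (W.baseChange K).LambdaAdicSelmerData κ γ) (F : HeegnerFamily N W K κ jbar)
          (X : (W.baseChange K).SelmerDualData κ γ) (j : ℤ_[p] →+* unrIntegers p),
          ¬ (p : ℤ) ∣ F.Dt.c →
          (∀ x : ℤ_[p], ((j x : unrIntegers p) : ℂ_[p]) = algebraMap ℚ_[p] ℂ_[p] (x : ℚ_[p])) →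
          heegnerCharIdeal D F ^ 2 ≤
              Module.charIdeal (IwasawaAlgebra p) (Submodule.torsion (IwasawaAlgebra p) X.X) →
            L ∈ (AcSelmer.XAc.charIdeal (W.baseChange K) p κ vbar ∅ γ).map (PowerSeries.map j))
    (h422 : BurungaleCastellaSkinner2025.prop422_exists_isBDPLFunction_mu_eq_zero)
    (h513 : thm513_exists_isBDPLFunction_valueAtOne_disc)
    (hC : ∀ (N : ℕ) [NeZero N], IsNewformOf.level_eq_conductorNorm (N := N))
    (h331 : thm331_anticyclotomicControl)
    (s_env : ∀ (W : WeierstrassCurve ℚ) [W.IsElliptic] [W.IsGloballyMinimal] (p : ℕ) [Fact p.Prime]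
      [NeZero (W.conductorNorm ℤ)] (K : Type) [Field K] [NumberField K],
      Literature.NumberTheory.EllipticCurves.Rank1Residual.ClassX10 W p →
      ¬ Literature.NumberTheory.EllipticCurves.Rank1Residual.Surj W 3 → ¬ W.HasCM →
      Literature.NumberTheory.EllipticCurves.IsImaginaryQuadratic K → Odd (NumberField.discr K) →
      NumberField.discr K ≠ -3 →
      Literature.NumberTheory.EllipticCurves.SatisfiesHeegnerHypothesis (W.conductorNorm ℤ) K →
      Literature.NumberTheory.EllipticCurves.SatisfiesHeegnerHypothesis p K →
      p ∣ NumberField.classNumber K →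
      ∀ (κ : Literature.NumberTheory.EllipticCurves.ZpExtension K p), κ.IsAnticyclotomic →
      ∀ (γ : Field.absoluteGaloisGroup K), κ.IsTopGenerator γ →
      ∀ (Dt : Literature.NumberTheory.EllipticCurves.ModularForms.ModularParametrizationData W
        (W.conductorNorm ℤ))
        (H : Literature.NumberTheory.EllipticCurves.HeegnerDatum (W.conductorNorm ℤ) (NumberField.discr K))
        (jbar : AlgebraicClosure K →+* ℂ) (D : (W.baseChange K).LambdaAdicSelmerData κ γ),
      ¬ (p : ℤ) ∣ Dt.c →
      ∃ (C : Literature.NumberTheory.EllipticCurves.CastellaGrossiLeeSkinner2022.StabilizedHeegnerData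
          (W.conductorNorm ℤ) W K κ jbar)
        (F : Literature.NumberTheory.EllipticCurves.HeegnerFamily (W.conductorNorm ℤ) W K κ jbar) (e : ℕ),
        C.Dt = Dt ∧ F.Dt = Dt ∧
        Ideal.span {((p : Literature.NumberTheory.EllipticCurves.IwasawaAlgebra p) ^ e)} *
            Literature.NumberTheory.EllipticCurves.heegnerCharIdeal D F ≤
          Literature.NumberTheory.EllipticCurves.CastellaGrossiLeeSkinner2022.stabilizedHeegnerCharIdeal D C ∧
        Module.IsTorsion (Literature.NumberTheory.EllipticCurves.IwasawaAlgebra p)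
          (D.S ⧸ Literature.NumberTheory.EllipticCurves.heegnerModule D F))
    (hμle : ∀ (W : WeierstrassCurve ℚ) [W.IsElliptic] [W.IsGloballyMinimal] (p : ℕ) [Fact p.Prime]
      [NeZero (W.conductorNorm ℤ)] (K : Type) [Field K] [NumberField K],
      Literature.NumberTheory.EllipticCurves.Rank1Residual.ClassX10 W p →
      ¬ Literature.NumberTheory.EllipticCurves.Rank1Residual.Surj W 3 → ¬ W.HasCM →
      Literature.NumberTheory.EllipticCurves.IsImaginaryQuadratic K → Odd (NumberField.discr K) →
      NumberField.discr K ≠ -3 →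
      Literature.NumberTheory.EllipticCurves.SatisfiesHeegnerHypothesis (W.conductorNorm ℤ) K →
      Literature.NumberTheory.EllipticCurves.SatisfiesHeegnerHypothesis p K →
      p ∣ NumberField.classNumber K →
      (W.baseChange K).HasIrreducibleModPGaloisRep p →
      ∀ (κ : Literature.NumberTheory.EllipticCurves.ZpExtension K p), κ.IsAnticyclotomic →
      ∀ (γ : Field.absoluteGaloisGroup K), κ.IsTopGenerator γ →
      ∀ (Dt : Literature.NumberTheory.EllipticCurves.ModularForms.ModularParametrizationData W
        (W.conductorNorm ℤ)) (jbar : AlgebraicClosure K →+* ℂ),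
      ¬ (p : ℤ) ∣ Dt.c → (W.baseChange K).mordellWeilRank = 1 →
      Finite (AddCommGroup.primaryComponent (W.baseChange K).sha p) →
      ∀ (D : (W.baseChange K).LambdaAdicSelmerData κ γ)
        (F : Literature.NumberTheory.EllipticCurves.HeegnerFamily (W.conductorNorm ℤ) W K κ jbar)
        (X : (W.baseChange K).SelmerDualData κ γ), F.Dt = Dt →
        Module.Finite (Literature.NumberTheory.EllipticCurves.IwasawaAlgebra p) D.S →
        Module.Finite (Literature.NumberTheory.EllipticCurves.IwasawaAlgebra p) X.X →
        Module.IsTorsion (Literature.NumberTheory.EllipticCurves.IwasawaAlgebra p)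
          (D.S ⧸ Literature.NumberTheory.EllipticCurves.heegnerModule D F) →
      ∀ 𝔭 : PrimeSpectrum (Literature.NumberTheory.EllipticCurves.IwasawaAlgebra p),
        𝔭.asIdeal = Ideal.span {(p : Literature.NumberTheory.EllipticCurves.IwasawaAlgebra p)} →
        Module.lengthAt (Literature.NumberTheory.EllipticCurves.IwasawaAlgebra p)
          (Submodule.torsion (Literature.NumberTheory.EllipticCurves.IwasawaAlgebra p) X.X) 𝔭 ≤
        2 * Module.lengthAt (Literature.NumberTheory.EllipticCurves.IwasawaAlgebra p)
          (D.S ⧸ Literature.NumberTheory.EllipticCurves.heegnerModule D F) 𝔭) :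
    ∀ (W : WeierstrassCurve ℚ) [W.IsElliptic] [W.IsGloballyMinimal] (p : ℕ) [Fact p.Prime]
    [NeZero (W.conductorNorm ℤ)] (K : Type) [Field K] [NumberField K],
    Literature.NumberTheory.EllipticCurves.Rank1Residual.ClassX10 W p →
    ¬ Literature.NumberTheory.EllipticCurves.Rank1Residual.Surj W 3 → ¬ W.HasCM →
    Literature.NumberTheory.EllipticCurves.IsImaginaryQuadratic K → Odd (NumberField.discr K) →
    NumberField.discr K ≠ -3 →
    Literature.NumberTheory.EllipticCurves.SatisfiesHeegnerHypothesis (W.conductorNorm ℤ) K →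
    Literature.NumberTheory.EllipticCurves.SatisfiesHeegnerHypothesis p K →
    p ∣ NumberField.classNumber K →
    (W.baseChange K).HasIrreducibleModPGaloisRep p →
    ∀ (ι : K →+* ℚ_[p]) (κ : Literature.NumberTheory.EllipticCurves.ZpExtension K p), κ.IsAnticyclotomic →
    ∀ (γ : Field.absoluteGaloisGroup K) [Fact (κ.IsTopGenerator γ)]
    (Dt : Literature.NumberTheory.EllipticCurves.ModularForms.ModularParametrizationData W
    (W.conductorNorm ℤ)), ¬ (p : ℤ) ∣ Dt.c →
    ∀ (H : Literature.NumberTheory.EllipticCurves.HeegnerDatum (W.conductorNorm ℤ) (NumberField.discr K))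
    (ιC : K →+* ℂ) (P : (W.baseChange K).toAffine.Point),
    WeierstrassCurve.Affine.Point.map ιC.toRatAlgHom P =
    Literature.NumberTheory.EllipticCurves.ModularForms.heegnerPointComplex Dt H →
    (W.baseChange K).mordellWeilRank = 1 →
    Finite (AddCommGroup.primaryComponent (W.baseChange K).sha p) → ¬ IsOfFinAddOrder P →
    ∃ n : ℕ, Summit.BirchSwinnertonDyer.Rank1Residual.X11b.AcSelmer.XAc.HasCharValuationAt
    (W.baseChange K) p κ (Summit.BirchSwinnertonDyer.Rank1Residual.X11b.inducedPlace ι) ∅ γ n ∧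
    (n : ℤ) ≤ 2 * (Summit.BirchSwinnertonDyer.Rank1Residual.X11b.padicLogOrd W p ι P +
    (padicValInt p (1 - W.frobeniusTrace p + p) : ℤ) - 1) := by
  intro W _ _ p _ _ K _ _ hX hns hcm hK hodd h3 hHN hHp hhK hirr ι κ hκ γ _ Dt hc H ιC P hP hrk hfin hPinf
  have hγ : κ.IsTopGenerator γ := Fact.out
  -- an embedding `K̄ → ℂ` over `ιC` for the tied family
  letI : Algebra K ℂ := ιC.toAlgebra
  let jbar : AlgebraicClosure K →+* ℂ :=
    (IsAlgClosed.lift (R := K) (M := ℂ) (S := AlgebraicClosure K)).toRingHom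
  -- the data exist (tree theorems)
  obtain ⟨D⟩ := WeierstrassCurve.LambdaAdicSelmerDataExists.nonempty_lambdaAdicSelmerData (W.baseChange K) p κ hγ
  obtain ⟨X⟩ := (W.baseChange K).nonempty_selmerDualData_holds κ γ hγ
  -- the envelope OUTPUTS `(C, F)` on `Dt`
  obtain ⟨C, F, e, -, hFDt, henv, htors⟩ := s_env W p K hX hns hcm hK hodd h3 hHN hHp hhK κ hκ γ hγ Dt H jbar D hc
  -- CGLS Thm. 4.1.3 at `(D, C, X)`
  have hyp := X10.thm413Hypotheses_of_classX10 hX hK h3 hHN hHp hodd hκ hγ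
  obtain ⟨⟨hfinS, -⟩, hfinX, -⟩ := hCGLS (W.conductorNorm ℤ) W K p κ γ jbar hyp D C X
  obtain ⟨m, hm⟩ := span_pow_mul_sq_le_charIdeal_torsion_of_thm413 hCGLS hyp
    (X9.selmerCorank_eq_one_of_rank_one hrk hfin) D C X
  -- `(p^{m+2e}) · I(ℋ_F)² ⊆ char(X_tors)`
  have hloc : Ideal.span {((p : IwasawaAlgebra p) ^ (m + e * 2))} * heegnerCharIdeal D F ^ 2 ≤
      Module.charIdeal (IwasawaAlgebra p) (Submodule.torsion (IwasawaAlgebra p) X.X) := by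
    calc Ideal.span {((p : IwasawaAlgebra p) ^ (m + e * 2))} * heegnerCharIdeal D F ^ 2
        = Ideal.span {((p : IwasawaAlgebra p) ^ m)} *
            (Ideal.span {((p : IwasawaAlgebra p) ^ e)} * heegnerCharIdeal D F) ^ 2 := by
          rw [span_singleton_mul_sq_eq', ← pow_mul, ← pow_add]
      _ ≤ Ideal.span {((p : IwasawaAlgebra p) ^ m)} * stabilizedHeegnerCharIdeal D C ^ 2 :=
          Ideal.mul_mono_right (Ideal.pow_right_mono henv 2)
      _ ≤ _ := hm
  -- the μ-part: promotion by the μ-INEQUALITY `μ(X_tors) ≤ 2 μ(𝔖/ℋ_F)`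
  haveI := hfinX
  haveI := hfinS
  haveI : IsNoetherian (IwasawaAlgebra p) X.X := isNoetherian_of_isNoetherianRing_of_finite _ _
  haveI : Module.Finite (IwasawaAlgebra p) (Submodule.torsion (IwasawaAlgebra p) X.X) := inferInstance
  haveI : Module.Finite (IwasawaAlgebra p) (D.S ⧸ heegnerModule D F) := inferInstance
  have hle : heegnerCharIdeal D F ^ 2 ≤
      Module.charIdeal (IwasawaAlgebra p) (Submodule.torsion (IwasawaAlgebra p) X.X) :=
    IwasawaAlgebra.sq_charIdeal_le_charIdeal_of_span_p_pow_mul_le_of_lengthAt_le_two_mul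
      (Submodule.torsion_isTorsion (R := IwasawaAlgebra p) (M := X.X)) htors
      (hμle W p K hX hns hcm hK hodd h3 hHN hHp hhK hirr κ hκ γ hγ Dt jbar hc hrk hfin D F X hFDt hfinS hfinX
        htors) hloc
  -- the pinned class-number-free transfer, then the `≤` half
  obtain ⟨hp3, hord, -, -⟩ := id hX
  subst hp3
  exact upperLink_of_imcWaldspurgerOnTreeGoodAt
    (imcWaldspurgerOnTreeGoodAt_inducedPlace_of_printFacts_of_pinnedTransfer h57 h59gp h422 h513 hC h331
      le_rfl hord hK hodd h3 rfl hHN hHp hirr ι κ hκ γ Dt hc H ιC P hP hrk hfin hPinf ⟨jbar, D, F, X, hFDt, hle⟩)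

/-- **The crux `BeyondCarrierDepthX10b` (stmt-23055) BY NAME from the TWO open statements of skeleton v6 —
the envelope `s_env` and the μ-INEQUALITY `hμle` (`μ(X_tors) ≤ 2 μ(𝔖/ℋ_F)` for the tied family) on the
`3 ∣ h_K` X10b frames — modulo ten cite-only facts (the SHARP v6.1 CENSUS theorem).** Coprime half: x10b-p1-w2's pinned road (`upperLinkX10b_coprimeClassNumber_of_pinnedPrintFacts`,
p609477: `h46` MZ26 Cor. 4.6 tied + the pinned transfer); divisible half: the theorem above; glue:
`stub_beyondCarrier_of_upperLink_of_namedFacts` (`h331 hChaL hKo`, p609388/p607624). Numbers: 2 open statements;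
10 facts, of which `h46` serves only the `3 ∤ h_K` frames, `hCGLS` only the `3 ∣ h_K` frames, and `hChaL` is
not a `closes` binder of PrintX10b rev 19. [cite: MastellaZerman2026, Cor. 4.6]
[cite: CastellaGrossiLeeSkinner2022, Thm. 4.1.3 and Thm. 5.1.3] [cite: YanZhu2024MainConjNonCM, Thm. 5.7 (1), 5.9]
[cite: BurungaleCastellaSkinner2025, Prop. 4.2.2] [cite: JetchevSkinnerWan2017, Thm. 3.3.1] [cite: Cha2005, Rmk. 25]
[cite: Kolyvagin1990, Thm. A] [cite: Washington1997, §13.2] -/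
theorem beyondCarrierDepthX10b_of_envelope_of_muLe_of_namedFacts
    (h46 : MastellaZerman2026.cor46_howardDivisibility_of_scalarImage.{0})
    (hCGLS : thm413_rankOne_charIdeal_torsion_dvd_localized.{0})
    (h57 : thm57_isTorsion_charIdealXGr_eq_bdpLFunction)
    (h59gp : ∀ {p : ℕ} [Fact p.Prime] (ι' : PadicAlgCl p ≃+* ℂ) (W : WeierstrassCurve ℚ) [W.IsElliptic]
      [W.IsGloballyMinimal] (K : Type) [Field K] [NumberField K] (v vbar : HeightOneSpectrum (𝓞 K))
      (κ : ZpExtension K p) (γ : absoluteGaloisGroup K) [Fact (κ.IsTopGenerator γ)] {N : ℕ} [NeZero N]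
      {f : CuspForm (CongruenceSubgroup.Gamma0 N) 2} (jbar : AlgebraicClosure K →+* ℂ)
      (_ : IsNewformOf W f),
      N = W.conductorNorm ℤ → 3 ≤ p → GoodOrd W p → (W.baseChange K).HasIrreducibleModPGaloisRep p →
      IsImaginaryQuadratic K → SatisfiesHeegnerHypothesis N K →
        ((Ideal.span {(p : ℤ)}).primesOver (𝓞 K)).ncard = 2 →
        Odd (NumberField.discr K) → NumberField.discr K ≠ -3 → κ.IsAnticyclotomic →
      (∀ (w : InfinitePlace K) (k : 𝓞 K), k ∈ v.asIdeal ↔ ‖ι'.symm (w.embedding (k : K))‖ < 1) →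
        ((p : ℕ) : 𝓞 K) ∈ vbar.asIdeal → vbar ≠ v →
      ∃ (ΩK : ℂ) (Ωp : (unrIntegers p)ˣ) (L : UnrSeries p),
        ΩK ≠ 0 ∧ IsBDPLFunction ι' v κ γ f ΩK ((Ωp : unrIntegers p) : ℂ_[p]) L ∧
        ∀ (D : (W.baseChange K).LambdaAdicSelmerData κ γ) (F : HeegnerFamily N W K κ jbar)
          (X : (W.baseChange K).SelmerDualData κ γ) (j : ℤ_[p] →+* unrIntegers p),
          ¬ (p : ℤ) ∣ F.Dt.c →
          (∀ x : ℤ_[p], ((j x : unrIntegers p) : ℂ_[p]) = algebraMap ℚ_[p] ℂ_[p] (x : ℚ_[p])) →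
          heegnerCharIdeal D F ^ 2 ≤
              Module.charIdeal (IwasawaAlgebra p) (Submodule.torsion (IwasawaAlgebra p) X.X) →
            L ∈ (AcSelmer.XAc.charIdeal (W.baseChange K) p κ vbar ∅ γ).map (PowerSeries.map j))
    (h422 : BurungaleCastellaSkinner2025.prop422_exists_isBDPLFunction_mu_eq_zero)
    (h513 : thm513_exists_isBDPLFunction_valueAtOne_disc)
    (hC : ∀ (N : ℕ) [NeZero N], IsNewformOf.level_eq_conductorNorm (N := N))
    (h331 : thm331_anticyclotomicControl)
    (hChaL : Cha2005.rmk25_pow_dvd_card_sha_primary_of_certificate)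
    (hKo : ∀ (N : ℕ) [NeZero N] (W : WeierstrassCurve ℚ) (K : Type) [Field K] [NumberField K],
      kolyvagin N W K)
    (s_env : ∀ (W : WeierstrassCurve ℚ) [W.IsElliptic] [W.IsGloballyMinimal] (p : ℕ) [Fact p.Prime]
      [NeZero (W.conductorNorm ℤ)] (K : Type) [Field K] [NumberField K],
      Literature.NumberTheory.EllipticCurves.Rank1Residual.ClassX10 W p →
      ¬ Literature.NumberTheory.EllipticCurves.Rank1Residual.Surj W 3 → ¬ W.HasCM →
      Literature.NumberTheory.EllipticCurves.IsImaginaryQuadratic K → Odd (NumberField.discr K) →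
      NumberField.discr K ≠ -3 →
      Literature.NumberTheory.EllipticCurves.SatisfiesHeegnerHypothesis (W.conductorNorm ℤ) K →
      Literature.NumberTheory.EllipticCurves.SatisfiesHeegnerHypothesis p K →
      p ∣ NumberField.classNumber K →
      ∀ (κ : Literature.NumberTheory.EllipticCurves.ZpExtension K p), κ.IsAnticyclotomic →
      ∀ (γ : Field.absoluteGaloisGroup K), κ.IsTopGenerator γ →
      ∀ (Dt : Literature.NumberTheory.EllipticCurves.ModularForms.ModularParametrizationData W
        (W.conductorNorm ℤ))
        (H : Literature.NumberTheory.EllipticCurves.HeegnerDatum (W.conductorNorm ℤ) (NumberField.discr K))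
        (jbar : AlgebraicClosure K →+* ℂ) (D : (W.baseChange K).LambdaAdicSelmerData κ γ),
      ¬ (p : ℤ) ∣ Dt.c →
      ∃ (C : Literature.NumberTheory.EllipticCurves.CastellaGrossiLeeSkinner2022.StabilizedHeegnerData
          (W.conductorNorm ℤ) W K κ jbar)
        (F : Literature.NumberTheory.EllipticCurves.HeegnerFamily (W.conductorNorm ℤ) W K κ jbar) (e : ℕ),
        C.Dt = Dt ∧ F.Dt = Dt ∧
        Ideal.span {((p : Literature.NumberTheory.EllipticCurves.IwasawaAlgebra p) ^ e)} *
            Literature.NumberTheory.EllipticCurves.heegnerCharIdeal D F ≤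
          Literature.NumberTheory.EllipticCurves.CastellaGrossiLeeSkinner2022.stabilizedHeegnerCharIdeal D C ∧
        Module.IsTorsion (Literature.NumberTheory.EllipticCurves.IwasawaAlgebra p)
          (D.S ⧸ Literature.NumberTheory.EllipticCurves.heegnerModule D F))
    (hμle : ∀ (W : WeierstrassCurve ℚ) [W.IsElliptic] [W.IsGloballyMinimal] (p : ℕ) [Fact p.Prime]
      [NeZero (W.conductorNorm ℤ)] (K : Type) [Field K] [NumberField K],
      Literature.NumberTheory.EllipticCurves.Rank1Residual.ClassX10 W p →
      ¬ Literature.NumberTheory.EllipticCurves.Rank1Residual.Surj W 3 → ¬ W.HasCM →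
      Literature.NumberTheory.EllipticCurves.IsImaginaryQuadratic K → Odd (NumberField.discr K) →
      NumberField.discr K ≠ -3 →
      Literature.NumberTheory.EllipticCurves.SatisfiesHeegnerHypothesis (W.conductorNorm ℤ) K →
      Literature.NumberTheory.EllipticCurves.SatisfiesHeegnerHypothesis p K →
      p ∣ NumberField.classNumber K →
      (W.baseChange K).HasIrreducibleModPGaloisRep p →
      ∀ (κ : Literature.NumberTheory.EllipticCurves.ZpExtension K p), κ.IsAnticyclotomic →
      ∀ (γ : Field.absoluteGaloisGroup K), κ.IsTopGenerator γ →
      ∀ (Dt : Literature.NumberTheory.EllipticCurves.ModularForms.ModularParametrizationData W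
        (W.conductorNorm ℤ)) (jbar : AlgebraicClosure K →+* ℂ),
      ¬ (p : ℤ) ∣ Dt.c → (W.baseChange K).mordellWeilRank = 1 →
      Finite (AddCommGroup.primaryComponent (W.baseChange K).sha p) →
      ∀ (D : (W.baseChange K).LambdaAdicSelmerData κ γ)
        (F : Literature.NumberTheory.EllipticCurves.HeegnerFamily (W.conductorNorm ℤ) W K κ jbar)
        (X : (W.baseChange K).SelmerDualData κ γ), F.Dt = Dt →
        Module.Finite (Literature.NumberTheory.EllipticCurves.IwasawaAlgebra p) D.S →
        Module.Finite (Literature.NumberTheory.EllipticCurves.IwasawaAlgebra p) X.X →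
        Module.IsTorsion (Literature.NumberTheory.EllipticCurves.IwasawaAlgebra p)
          (D.S ⧸ Literature.NumberTheory.EllipticCurves.heegnerModule D F) →
      ∀ 𝔭 : PrimeSpectrum (Literature.NumberTheory.EllipticCurves.IwasawaAlgebra p),
        𝔭.asIdeal = Ideal.span {(p : Literature.NumberTheory.EllipticCurves.IwasawaAlgebra p)} →
        Module.lengthAt (Literature.NumberTheory.EllipticCurves.IwasawaAlgebra p)
          (Submodule.torsion (Literature.NumberTheory.EllipticCurves.IwasawaAlgebra p) X.X) 𝔭 ≤
        2 * Module.lengthAt (Literature.NumberTheory.EllipticCurves.IwasawaAlgebra p)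
          (D.S ⧸ Literature.NumberTheory.EllipticCurves.heegnerModule D F) 𝔭) :
    BeyondCarrierDepthX10b := by
  refine stub_beyondCarrier_of_upperLink_of_namedFacts h331 hChaL hKo ?_
  intro W _ _ p _ _ K _ _ hX hns hcm hK hodd h3 hHN hHp hirr ι κ hκ γ _ Dt hc H ιC P hP hrk hfin hPinf
  by_cases hh : p ∣ NumberField.classNumber K
  · exact upperLinkX10b_divisibleClassNumber_of_envelope_of_muLe_of_printFacts hCGLS h57 h59gp h422 h513 hC
      h331 s_env hμle W p K hX hns hcm hK hodd h3 hHN hHp hh hirr ι κ hκ γ Dt hc H ιC P hP hrk hfin hPinf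
  · exact upperLinkX10b_coprimeClassNumber_of_pinnedPrintFacts h46 h57 h59gp h422 h513 hC h331 W p K hX hns
      hcm hK hodd h3 hHN hHp hirr hh ι κ hκ γ Dt hc H ιC P hP hrk hfin hPinf

end Summit.BirchSwinnertonDyer.BirchSwinnertonDyer.Cruxes.BeyondCarrierDepthX10b.HowardFrames

end
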